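import Summits.QuantumAdvantage.QuantumAdvantage.Theses.LinnikCubicClassGroups
import Summits.QuantumAdvantage.QuantumAdvantage.Theorems.LinnikCubicClassGroupsPureCubicClassGroupFBQPStubCubicFieldFacts
import Literature.Computability.Complexity.RandomizedProofs
import Literature.Computability.Complexity.PCPProofs

/-!
# `PureCubicClassNumberHard`: well-posedness and load-bearing analysis (negative knowledge)

Crux `stmt-QuantumAdvantage-11826` (route `LinnikCubicClassGroups`, rank-0 hypothesis-type target
`X = PureCubicClassNumberHard`: no PPT algorithm prints, on every non-cube `m = decodeNat x` and
every cubic number field `K ∋ ∛m`, the `2|x|+8` low bits of `h_K` with probability `≥ 2/3`).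
Refuter work file: `Summits/QuantumAdvantage/QuantumAdvantage/Cruxes/PureCubicClassNumberHard/Disproof.lean`.

Nothing here asserts `X` or `¬X` (an open classical-hardness hypothesis). Contents:

* §1 WELL-POSEDNESS: all admissible fields for one input are `ℚ`-isomorphic to `ℚ[X]/(X³ − m)`
  (`nonempty_algEquiv_adjoinRoot`) and have the same class number (`classNumber_eq_of_admissible`);
  the demanded output is one function `targetBits` (`targetBits_eq`).
* §2 NORMAL FORM `crux_iff_targetBits_hard : X ↔ TargetBitsHard` (hardness of that one function).
* §3 `pureCubicClassNumberHard_false_without_PolyTime`: with `A.IsPolyTime id id` dropped the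
  statement is FALSE — the time bound is the whole content of `X`.
* §4 `not_pointwise_hard`: the pointwise variant (`∀ x ∃ A`) is FALSE (constant algorithms are PPT).
* §5 threshold: `crux_iff_hardAtThreshold`, `hardAtThreshold_mono`, `hard_of_one_lt_threshold`
  (any threshold `> 1` holds vacuously-true; instances exist at `m = 2`).
* §6 `withoutNonCube_of_two_cubic_fields`: dropping the non-cube clause makes the statement TRUE
  for a silly reason, given two cubic fields whose class numbers differ in the low 16 bits
  (`h(ℚ(∛2)) = 1`, `h(ℚ(∛7)) = 3` by PARI; an explicit hypothesis here, not certifiable in Mathlib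
  today).
* (sequel `Negative/InfinitelyOften.lean`: `X ↔` every PPT algorithm fails on infinitely many inputs.)
-/

namespace Summit.QuantumAdvantage.QuantumAdvantage.Theorems.PureCubicClassNumberHard.Negative

open Literature.Computability.Complexity _root_.Computability
open Summit.QuantumAdvantage.QuantumAdvantage.Theses.LinnikCubicClassGroups
  (PureCubicClassNumberHard)
open Summit.QuantumAdvantage.QuantumAdvantage.Theorems.LinnikCubicClassGroups
  (facts_irreducible factsExists)

/-! ## §1 Well-posedness: all admissible fields are isomorphic; the target is one function -/

open Polynomial in
/-- Every admissible field of the crux (a number field of degree `3` containing a cube root of the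
non-cube `m`) is `ℚ`-isomorphic to the model `ℚ[X]/(X³ − m)`: `X³ − m` is irreducible (tree:
`facts_irreducible`, rational root theorem), so the lift `ℚ[X]/(X³−m) →ₐ[ℚ] K` through the cube root
is an injective `ℚ`-linear map between spaces of equal dimension `3`, hence bijective. [folklore] -/
theorem nonempty_algEquiv_adjoinRoot {m : ℕ} (hm : ∀ r : ℕ, r ^ 3 ≠ m) (K : Type) [Field K]
    [NumberField K] (h3 : Module.finrank ℚ K = 3) (hα : ∃ α : K, α ^ 3 = (m : K)) :
    Nonempty (AdjoinRoot (X ^ 3 - C (m : ℚ)) ≃ₐ[ℚ] K) := by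
  haveI : Fact (Irreducible (X ^ 3 - C (m : ℚ))) := ⟨facts_irreducible m hm⟩
  have hf0 : (X ^ 3 - C (m : ℚ)) ≠ 0 := (monic_X_pow_sub_C _ three_ne_zero).ne_zero
  obtain ⟨α, hα⟩ := hα
  have heval : (X ^ 3 - C (m : ℚ)).eval₂ (Algebra.ofId ℚ K) α = 0 := by
    simp [eval₂_sub, eval₂_X_pow, hα]
  let φ : AdjoinRoot (X ^ 3 - C (m : ℚ)) →ₐ[ℚ] K :=
    AdjoinRoot.liftAlgHom (X ^ 3 - C (m : ℚ)) (Algebra.ofId ℚ K) α heval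
  have hinj : Function.Injective φ := φ.toRingHom.injective
  let pb := AdjoinRoot.powerBasis hf0
  haveI : FiniteDimensional ℚ (AdjoinRoot (X ^ 3 - C (m : ℚ))) := pb.finite
  have hdim : Module.finrank ℚ (AdjoinRoot (X ^ 3 - C (m : ℚ))) = Module.finrank ℚ K := by
    rw [pb.finrank, AdjoinRoot.powerBasis_dim, natDegree_X_pow_sub_C, h3]
  have hsurj : Function.Surjective φ :=
    (LinearMap.injective_iff_surjective_of_finrank_eq_finrank hdim (f := φ.toLinearMap)).mp hinj
  exact ⟨AlgEquiv.ofBijective φ ⟨hinj, hsurj⟩⟩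

/-- The class number is invariant under ring isomorphism of number fields (Mathlib:
`ClassGroup.mulEquiv`, `NumberField.RingOfIntegers.mapRingEquiv`, `Fintype.card_congr`). [folklore] -/
theorem classNumber_eq_of_ringEquiv {K K' : Type*} [Field K] [NumberField K] [Field K']
    [NumberField K'] (e : K ≃+* K') : NumberField.classNumber K = NumberField.classNumber K' := by
  unfold NumberField.classNumber
  exact Fintype.card_congr (ClassGroup.mulEquiv (NumberField.RingOfIntegers.mapRingEquiv e)).toEquiv

/-- WELL-POSEDNESS of the crux: for a fixed non-cube `m`, all admissible fields have the same class
number (they are pairwise isomorphic through the model `ℚ[X]/(X³ − m)`). [folklore] -/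
theorem classNumber_eq_of_admissible {m : ℕ} (hm : ∀ r : ℕ, r ^ 3 ≠ m)
    (K : Type) [Field K] [NumberField K] (h3 : Module.finrank ℚ K = 3)
    (hα : ∃ α : K, α ^ 3 = (m : K))
    (K' : Type) [Field K'] [NumberField K'] (h3' : Module.finrank ℚ K' = 3)
    (hα' : ∃ α : K', α ^ 3 = (m : K')) :
    NumberField.classNumber K = NumberField.classNumber K' := by
  obtain ⟨e⟩ := nonempty_algEquiv_adjoinRoot hm K h3 hα
  obtain ⟨e'⟩ := nonempty_algEquiv_adjoinRoot hm K' h3' hα'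
  exact classNumber_eq_of_ringEquiv (e.symm.trans e').toRingEquiv

/-- An admissible field for the input value `m`, bundled (carrier in `Type`, as in the crux). -/
structure Admissible (m : ℕ) : Type 1 where
  /-- the carrier -/
  K : Type
  [instField : Field K]
  [instNumberField : NumberField K]
  finrank_eq : Module.finrank ℚ K = 3
  exists_cubeRoot : ∃ α : K, α ^ 3 = (m : K)

attribute [instance] Admissible.instField Admissible.instNumberField

/-- The tree's `factsExists` repackaged: for a non-cube `m` an admissible field exists. [folklore] -/
theorem nonempty_admissible {m : ℕ} (hm : ∀ r : ℕ, r ^ 3 ≠ m) : Nonempty (Admissible m) := by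
  obtain ⟨K, _, _, h3, hα⟩ := factsExists m hm
  exact ⟨⟨K, h3, hα⟩⟩

/-- The output string the crux demands on input `x` for the field `K`: the `2|x|+8` low bits of
`h_K`, least significant first. -/
def bitsOf (x : List Bool) (h : ℕ) : List Bool :=
  List.ofFn (fun i : Fin (2 * x.length + 8) => h.testBit i.val)

open scoped Classical in
/-- THE TARGET FUNCTION of the crux: on input `x`, the low `2|x|+8` bits of the class number of
(any) admissible field for `m = decodeNat x`, and `[]` if there is none (cube inputs). -/
noncomputable def targetBits (x : List Bool) : List Bool :=
  if h : Nonempty (Admissible (decodeNat x)) then bitsOf x (NumberField.classNumber h.some.K) else []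

/-- On an admissible pair `(x, K)` the target function IS the string demanded for `K`. [folklore] -/
theorem targetBits_eq (x : List Bool) (hm : ∀ r : ℕ, r ^ 3 ≠ decodeNat x) (K : Type) [Field K]
    [NumberField K] (h3 : Module.finrank ℚ K = 3) (hα : ∃ α : K, α ^ 3 = (decodeNat x : K)) :
    targetBits x = bitsOf x (NumberField.classNumber K) := by
  have hne : Nonempty (Admissible (decodeNat x)) := ⟨⟨K, h3, hα⟩⟩
  rw [targetBits, dif_pos hne, classNumber_eq_of_admissible hm hne.some.K hne.some.finrank_eq
    hne.some.exists_cubeRoot K h3 hα]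

/-! ## §2 Normal form: the crux is hardness of ONE explicit function -/

/-- **NORMAL FORM.** The crux is equivalent to PPT-hardness of the one total function `targetBits`
(success probability `≥ 2/3` demanded on every non-cube input): §1 removes the `∀ K`, and the
tree's `factsExists` supplies an admissible field at every non-cube input for the converse. Hence
`¬ X` is precisely a probabilistic polynomial-time algorithm (a `TM2ComputableAux` with a polynomial
step bound) computing the class number of `ℚ(∛m)` for every non-cube `m`; none is known (classical
record: Buchmann's `L(1/2)` method under GRH, Cohen 1993 §6.5). [folklore] -/
theorem crux_iff_targetBits_hard :
    PureCubicClassNumberHard ↔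
      ¬ ∃ A : RandAlg (List Bool) (List Bool), A.IsPolyTime id id ∧
        ∀ x : List Bool, (∀ r : ℕ, r ^ 3 ≠ decodeNat x) → (2 : ℝ) / 3 ≤ A.pr id x {targetBits x} := by
  unfold PureCubicClassNumberHard
  refine not_congr ⟨?_, ?_⟩
  · rintro ⟨A, hA, h⟩
    refine ⟨A, hA, fun x hm => ?_⟩
    obtain ⟨⟨K, h3, hα⟩⟩ := nonempty_admissible hm
    rw [targetBits_eq x hm K h3 hα]
    exact h x K h3 hm hα
  · rintro ⟨A, hA, h⟩
    refine ⟨A, hA, ?_⟩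
    intro x K _ _ h3 hm hα
    have hx := h x hm
    rw [targetBits_eq x hm K h3 hα] at hx
    exact hx

/-! ## §3 Load-bearing: the polynomial-time clause is the whole content -/

/-- **`A.IsPolyTime id id` is load-bearing**: with the time bound dropped the crux is FALSE, i.e.
SOME (computationally unbounded, coin-free) `RandAlg` meets the correctness demand on every
admissible `(x, K)` — namely `RandAlg.ofDet targetBits`, correct with probability `1` by
well-posedness (§1). So any proof of the crux is a genuine running-time lower bound. [folklore] -/
theorem exists_unbounded_randAlg_correct :
    ∃ A : RandAlg (List Bool) (List Bool),
      ∀ (x : List Bool) (K : Type) [Field K] [NumberField K], Module.finrank ℚ K = 3 →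
        (∀ r : ℕ, r ^ 3 ≠ decodeNat x) → (∃ α : K, α ^ 3 = (decodeNat x : K)) →
          (2 : ℝ) / 3 ≤ A.pr id x
            {List.ofFn (fun i : Fin (2 * x.length + 8) => (NumberField.classNumber K).testBit i.val)} := by
  refine ⟨RandAlg.ofDet targetBits, ?_⟩
  intro x K _ _ h3 hm hα
  classical
  rw [RandAlg.pr_ofDet, if_pos (by rw [Set.mem_singleton_iff, targetBits_eq x hm K h3 hα]; rfl)]
  norm_num

/-! ## §4 Quantifier order: pointwise hardness is false -/

/-- `decodeNat [false, true] = 2`. [folklore] -/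
theorem decodeNat_ft : decodeNat [false, true] = 2 := by decide

/-- `2` is not a perfect cube. [folklore] -/
theorem two_not_cube : ∀ r : ℕ, r ^ 3 ≠ 2 := by
  intro r h
  rcases lt_or_ge r 2 with hr | hr
  · interval_cases r <;> simp at h
  · have : 2 ^ 3 ≤ r ^ 3 := Nat.pow_le_pow_left hr 3
    omega

/-- The input `[false, true]` encodes the non-cube `2`. [folklore] -/
theorem ft_not_cube : ∀ r : ℕ, r ^ 3 ≠ decodeNat [false, true] := by
  rw [decodeNat_ft]; exact two_not_cube

/-- **Quantifier order is load-bearing**: the POINTWISE variant of the crux (`∀ x` outside,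
`¬ ∃ A` inside) is FALSE — at the non-cube input `x = [false, true]` (`m = 2`) the CONSTANT algorithm
printing `targetBits x` is PPT (tree facts `PolyTimeComputable.const`, `RandAlg.IsPolyTime.ofDet_holds`)
and correct with probability `1` for every admissible `K`. [folklore] -/
theorem exists_ppt_correct_at_input_two :
    ∃ A : RandAlg (List Bool) (List Bool), A.IsPolyTime id id ∧
      ∀ (K : Type) [Field K] [NumberField K], Module.finrank ℚ K = 3 →
        (∃ α : K, α ^ 3 = (decodeNat [false, true] : K)) →
          (2 : ℝ) / 3 ≤ A.pr id [false, true]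
            {List.ofFn (fun i : Fin (2 * [false, true].length + 8) =>
              (NumberField.classNumber K).testBit i.val)} := by
  refine ⟨RandAlg.ofDet (fun _ => targetBits [false, true]),
    RandAlg.IsPolyTime.ofDet_holds (PolyTimeComputable.const id id _), ?_⟩
  intro K _ _ h3 hα
  classical
  rw [RandAlg.pr_ofDet, if_pos (by
    rw [Set.mem_singleton_iff, targetBits_eq [false, true] ft_not_cube K h3 hα]; rfl)]
  norm_num

/-! ## §5 The success threshold -/

/-- A `RandAlg` event probability is at most `1` (re-proved; the tree's `RandAlg.pr_le_one` lives in
`Cryptography/OneWayFunctions`, outside this route's import cone). [folklore] -/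
theorem pr_le_one' (A : RandAlg (List Bool) (List Bool)) (x : List Bool) (E : Set (List Bool)) :
    A.pr id x E ≤ 1 := by
  unfold RandAlg.pr
  refine ENNReal.toReal_le_of_le_ofReal zero_le_one ?_
  rw [ENNReal.ofReal_one]
  calc (A.outputPMF id x).toOuterMeasure E
      ≤ (A.outputPMF id x).toOuterMeasure Set.univ :=
        (A.outputPMF id x).toOuterMeasure.mono (Set.subset_univ _)
    _ = 1 := (PMF.toOuterMeasure_apply_eq_one_iff _ _).2 (Set.subset_univ _)

/-- The probability of a singleton event is the output law's mass there. [folklore] -/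
theorem pr_singleton (A : RandAlg (List Bool) (List Bool)) (x v : List Bool) :
    A.pr id x {v} = ((A.outputPMF id x) v).toReal := by
  unfold RandAlg.pr
  rw [PMF.toOuterMeasure_apply_singleton]

/-- Two DIFFERENT output strings have total probability `≤ 1`. [folklore] -/
theorem pr_add_pr_le_one (A : RandAlg (List Bool) (List Bool)) (x : List Bool) {v w : List Bool}
    (hvw : v ≠ w) : A.pr id x {v} + A.pr id x {w} ≤ 1 := by
  rw [pr_singleton, pr_singleton,
    ← ENNReal.toReal_add (PMF.apply_ne_top _ v) (PMF.apply_ne_top _ w)]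
  refine ENNReal.toReal_le_of_le_ofReal zero_le_one ?_
  rw [ENNReal.ofReal_one, ← (A.outputPMF id x).tsum_coe, ← Finset.sum_pair hvw]
  exact ENNReal.sum_le_tsum _

/-- **Thresholds.** Hardness at threshold `c` implies hardness at every `c' ≥ c` (the crux is the
slice `c = 2/3`; on paper every `c ∈ (1/2, 1)` is equivalent by majority-vote amplification,
Arora–Barak 2009 Thm 7.10, not formalised here). [folklore] -/
theorem hardAtThreshold_mono {c c' : ℝ} (hcc' : c ≤ c')
    (h : ¬ ∃ A : RandAlg (List Bool) (List Bool), A.IsPolyTime id id ∧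
      ∀ (x : List Bool) (K : Type) [Field K] [NumberField K], Module.finrank ℚ K = 3 →
        (∀ r : ℕ, r ^ 3 ≠ decodeNat x) → (∃ α : K, α ^ 3 = (decodeNat x : K)) →
          c ≤ A.pr id x
            {List.ofFn (fun i : Fin (2 * x.length + 8) => (NumberField.classNumber K).testBit i.val)}) :
    ¬ ∃ A : RandAlg (List Bool) (List Bool), A.IsPolyTime id id ∧
      ∀ (x : List Bool) (K : Type) [Field K] [NumberField K], Module.finrank ℚ K = 3 →
        (∀ r : ℕ, r ^ 3 ≠ decodeNat x) → (∃ α : K, α ^ 3 = (decodeNat x : K)) →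
          c' ≤ A.pr id x
            {List.ofFn (fun i : Fin (2 * x.length + 8) => (NumberField.classNumber K).testBit i.val)} := by
  rintro ⟨A, hA, hc⟩
  refine h ⟨A, hA, ?_⟩
  intro x K _ _ h3 hm hα
  exact hcc'.trans (hc x K h3 hm hα)

/-- **A threshold `c > 1` holds for a silly reason** (probabilities are `≤ 1` and the instance set is
non-empty: `m = 2`, an admissible field exists by the tree's `factsExists`); so the crux's constant
must stay `≤ 1`, as it does. [folklore] -/
theorem hard_of_one_lt_threshold {c : ℝ} (hc : 1 < c) :
    ¬ ∃ A : RandAlg (List Bool) (List Bool), A.IsPolyTime id id ∧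
      ∀ (x : List Bool) (K : Type) [Field K] [NumberField K], Module.finrank ℚ K = 3 →
        (∀ r : ℕ, r ^ 3 ≠ decodeNat x) → (∃ α : K, α ^ 3 = (decodeNat x : K)) →
          c ≤ A.pr id x
            {List.ofFn (fun i : Fin (2 * x.length + 8) => (NumberField.classNumber K).testBit i.val)} := by
  rintro ⟨A, -, h⟩
  obtain ⟨⟨K, h3, hα⟩⟩ := nonempty_admissible (m := decodeNat [false, true]) ft_not_cube
  have h1 := h [false, true] K h3 ft_not_cube hα
  have hle := pr_le_one' A [false, true] {List.ofFn (fun i : Fin (2 * [false, true].length + 8) =>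
      (NumberField.classNumber K).testBit i.val)}
  linarith

/-! ## §6 The non-cube clause makes the statement non-trivial (inverted load-bearing) -/

/-- `decodeNat [false, false, false, true] = 8`, a cube. [folklore] -/
theorem decodeNat_ffft : decodeNat [false, false, false, true] = 8 := by decide

/-- **The non-cube clause is what makes `X` non-trivial**: with `∀ r, r³ ≠ decodeNat x` dropped the
statement becomes TRUE for a silly reason as soon as two cubic number fields have class numbers with
different low 16 bits (true by PARI — `h(ℚ(∛2)) = 1`, `h(ℚ(∛7)) = 3` — but Mathlib certifies no
class number of any cubic field, so the pair is a hypothesis here): at the cube input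
`x = [false,false,false,true]` (`m = 8 = 2³`) EVERY cubic number field is admissible, and no output
law puts mass `≥ 2/3` on two different strings (`pr_add_pr_le_one`). [folklore] -/
theorem withoutNonCube_of_two_cubic_fields
    (H : ∃ (K : Type) (_ : Field K) (_ : NumberField K) (K' : Type) (_ : Field K') (_ : NumberField K'),
      Module.finrank ℚ K = 3 ∧ Module.finrank ℚ K' = 3 ∧
        bitsOf [false, false, false, true] (NumberField.classNumber K) ≠
          bitsOf [false, false, false, true] (NumberField.classNumber K')) :
    ¬ ∃ A : RandAlg (List Bool) (List Bool), A.IsPolyTime id id ∧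
      ∀ (x : List Bool) (K : Type) [Field K] [NumberField K], Module.finrank ℚ K = 3 →
        (∃ α : K, α ^ 3 = (decodeNat x : K)) →
          (2 : ℝ) / 3 ≤ A.pr id x
            {List.ofFn (fun i : Fin (2 * x.length + 8) => (NumberField.classNumber K).testBit i.val)} := by
  rintro ⟨A, -, h⟩
  obtain ⟨K, _, _, K', _, _, h3, h3', hne⟩ := H
  have h8 : ∀ (L : Type) [Field L], ∃ α : L, α ^ 3 = (decodeNat [false, false, false, true] : L) :=
    fun L _ => ⟨2, by rw [decodeNat_ffft]; norm_num⟩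
  have hv := h [false, false, false, true] K h3 (h8 K)
  have hw := h [false, false, false, true] K' h3' (h8 K')
  have hsum := pr_add_pr_le_one A [false, false, false, true] hne
  unfold bitsOf at hsum
  linarith

end Summit.QuantumAdvantage.QuantumAdvantage.Theorems.PureCubicClassNumberHard.Negative
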